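import Literature.AnabelianGeometry.EtaleTheta.MonoThetaEnv

/-!
# Rigidity of mono-theta environments ([EtTh] §2: Prop 2.12, Prop 2.14, Cor 2.18, Cor 2.19 (i))

Mochizuki, *The Étale Theta Function …* [EtTh], Publ. RIMS 45 (2009), §2, PRIMS text pp.45–65
(locators `p.N` = PDF pages; bib key `MochizukiEtTh2009`). Statements-first: every printed
result is a named `Prop` fact over the interface `RigidData` (= `ThetaEnvData` + the theta
subquotients of Prop 2.12 + the labelled cusps of Cor 2.9), one decl per printed sub-item.

READING OF "FUNCTORIAL GROUP-THEORETIC ALGORITHM" (Cor 2.18 (i)–(iii), 2.19 (i), (iii)). The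
printed form is: "there exists an algorithm `Π• ↦ S(Π•)`, functorial in isomorphisms of
topological groups and referring to no isomorphism `Π• ≅ Π^tp_X`, such that ANY isomorphism
`Π• ≅ Π^tp_X` carries `S(Π•)` to `S`". For subgroups/subquotients/classes `S` this is
EQUIVALENT (classically) to: `S` is invariant under every automorphism of the topological group
`Π^tp_X` (resp. of the mono-theta environment) — given invariance, transport along any
isomorphism is well defined and functorial; conversely take `Π• = Π^tp_X`. We type the
invariance form, which is what [IUTchII] §1 consumes; the surplus "mono-anabelian" reading
the author attaches to the word "algorithm" is not a kernel-visible distinction and is recorded,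
not adjudicated. ERRATA READ: [IUTchI] Rmk 3.1.6 (kurims p.66): `l` odd, and Prop 2.12 must
exclude the orbicurve `Ċ` (our interface is for `X` of type `(1,(ℤ/lℤ)^Θ)` only);
[IUTchII] Rmk 1.1.1 (iv)–(v) (kurims pp.24–25): no change to the statement of Cor 2.19 (i).

Not in this file: projective systems / reductions `M_{N'}` (Cor 2.16, Cor 2.18 (iv) second
half, Cor 2.19 (ii), (iii) second half), Lemma 2.17, Prop 2.11 (ii) as a theorem.
-/

namespace Literature.AnabelianGeometry.EtaleTheta

universe u

/-- The union of the centralisers of the open subgroups of a topological group — the recipe of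
Prop 2.11 (ii) for `Ker(Π[μ_N] ↠ Π)`, and of Cor 2.18 (iii) for the quotient `Π• ↠ Π•_Y` of an
abstract mono-theta environment. [cite: MochizukiEtTh2009, Prop 2.11(ii) p.44] -/
def centralizerUnion (P : Type*) [Group P] [TopologicalSpace P] : Subgroup P where
  carrier := {z | ∃ U : Subgroup P, IsOpen (U : Set P) ∧ z ∈ Subgroup.centralizer (U : Set P)}
  mul_mem' := by
    rintro a b ⟨U, hU, ha⟩ ⟨V, hV, hb⟩
    refine ⟨U ⊓ V, hU.inter hV, Subgroup.mul_mem _ ?_ ?_⟩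
    · exact Subgroup.centralizer_le (Subgroup.coe_inf U V ▸ Set.inter_subset_left) ha
    · exact Subgroup.centralizer_le (Subgroup.coe_inf U V ▸ Set.inter_subset_right) hb
  one_mem' := ⟨⊤, by simp, Subgroup.one_mem _⟩
  inv_mem' := by
    rintro a ⟨U, hU, ha⟩
    exact ⟨U, hU, Subgroup.inv_mem _ ha⟩

/-- The "`K^×`, `(l·ℤ)`"-conjugates of a section `s : Π^tp_Ÿ → Π^tp_Y[μ_N]` (Prop 2.14 (ii); p.46–47):
the orbit of `s` under shifts by continuous cocycles inflated from `G_K` (the `K^×`-multiples) and under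
conjugation by `Π^tp_X` (the `l·ℤ = Gal(Y/X)`-conjugates). [cite: MochizukiEtTh2009, Prop 2.14(ii) p.49] -/
inductive ThetaEnvData.IsKLConjugate {N : ℕ+} (T : ThetaEnvData.{u} N) (s : T.PiYdd → T.env) :
    (T.PiYdd → T.env) → Prop
  | base : ThetaEnvData.IsKLConjugate T s s
  | kummer (t : T.PiYdd → T.env) (δ : T.G → T.mu)
      (hδ : CycEnvelope.IsEnvCocycle T.augY T.chi (δ ∘ T.augY))
      (hc : CycEnvelope.shift hδ ∈ contMulAut T.env) :
      ThetaEnvData.IsKLConjugate T s t →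
        ThetaEnvData.IsKLConjugate T s (fun g => CycEnvelope.shift hδ (t g))
  | gal (t : T.PiYdd → T.env) (x : T.PiX) :
      ThetaEnvData.IsKLConjugate T s t → ThetaEnvData.IsKLConjugate T s
        (fun g => T.conjX x (t ⟨x⁻¹ * g * x, by
          simpa [mul_assoc] using T.PiYdd_normal.conj_mem _ g.2 x⁻¹⟩))

/-- **Interface for the rigidity statements**: `ThetaEnvData` together with the theta
subquotients "(l·Δ_Θ) ⊆ (Δ^tp_Y)^Θ ⊆ (Π^tp_Y)^Θ of Π^tp_X" (p.45, Prop 2.12, Cor 2.18), given by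
their inverse images in `Π^tp_X`, the identification "(l·Δ_Θ) ↠ (l·Δ_Θ) ⊗ ℤ/Nℤ ≅ μ_N" (p.46),
and the labelled cusps (Cor 2.9: labels `∈ (ℤ/lℤ)^±` for `X`, `∈ ℤ` for `Y`, p.42). Axioms
quote print; TODO-merge(abc-iut-L2-t1) as for `ThetaEnvData`.
[cite: MochizukiEtTh2009, Cor 2.18 p.59] -/
structure RigidData (N : ℕ+) (l : ℕ) extends ThetaEnvData.{u} N where
  /-- `Ker(Π^tp_X ↠ (Π^tp_X)^Θ)` = "the kernel of `Δ_X ↠ Δ^Θ_X`" (p.35, p.45) -/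
  thetaKer : Subgroup PiX
  /-- it is normal -/
  thetaKer_normal : thetaKer.Normal
  /-- it lies in `Δ^tp_Ÿ = Π^tp_Ÿ ∩ Δ_X` (p.35: a subgroup of `Δ_X`; `Δ_X/Δ_Ÿ` is abelian) -/
  thetaKer_le : thetaKer ≤ PiYdd ⊓ aug.ker
  /-- the inverse image in `Π^tp_X` of `(l·Δ_Θ) ⊆ (Δ^tp_X)^Θ` (Prop 2.12 (i), p.45) -/
  lDeltaTheta : Subgroup PiX
  /-- `(l·Δ_Θ)` is a subquotient: its inverse image contains `thetaKer` -/
  thetaKer_le_lDeltaTheta : thetaKer ≤ lDeltaTheta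
  /-- `(l·Δ_Θ) ⊆ (Δ^tp_Ÿ)^Θ` (Prop 2.14 (i), p.49) -/
  lDeltaTheta_le : lDeltaTheta ≤ PiYdd ⊓ aug.ker
  /-- `(l·Δ_Θ)` is normal in `(Π^tp_X)^Θ` (it is central in `(Δ^tp_X)^Θ`, p.35) -/
  lDeltaTheta_normal : lDeltaTheta.Normal
  /-- "(l·Δ_Θ) ↠ (l·Δ_Θ) ⊗ (ℤ/Nℤ) ≅ μ_N" (p.46), as a homomorphism on the inverse image -/
  thetaMod : lDeltaTheta →* mu
  /-- it is onto `μ_N` -/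
  thetaMod_surjective : Function.Surjective thetaMod
  /-- its kernel is `thetaKer · (N-th powers)`: `(l·Δ_Θ) ≅ Ẑ(1)` is torsion-free procyclic -/
  thetaMod_ker : ∀ g : lDeltaTheta, thetaMod g = 1 ↔
    ∃ k ∈ thetaKer, ∃ h : lDeltaTheta, (g : PiX) = k * (h : PiX) ^ (N : ℕ)
  /-- `thetaMod` is `Π^tp_X`-equivariant for conjugation / the character (p.46 "natural") -/
  thetaMod_conj : ∀ (x : PiX) (g : lDeltaTheta),
    thetaMod ⟨x * g * x⁻¹, lDeltaTheta_normal.conj_mem _ g.2 x⟩ = chi (aug x) (thetaMod g)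
  /-- the theta cocycles vanish on `Ker(Π^tp_Ÿ ↠ (Π^tp_Ÿ)^Θ)`: "the theta and algebraic sections
  coincide over `Ker(Π•_Y ↠ (Π•_Y)^Θ)` [cf. Proposition 1.3]" (p.66) -/
  cocycle_thetaKer : ∀ η ∈ thetaCocycles, ∀ g : PiYdd, (g : PiX) ∈ thetaKer → η g = 1
  /-- on `(l·Δ_Θ)` the theta cocycles ARE the identification with `μ_N` ("the étale theta class
  determines an isomorphism between `Δ_Θ` and the cyclotomic coefficients", Rmk 2.19.2 p.67,
  Prop 1.3) -/
  cocycle_lDeltaTheta : ∀ η ∈ thetaCocycles, ∀ (g : PiYdd) (h : (g : PiX) ∈ lDeltaTheta),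
    η g = thetaMod ⟨g, h⟩
  /-- cusps of `Y` labelled by `ℤ` (p.42): label ↦ the conjugacy class of cuspidal decomposition
  groups in `Π^tp_Y` -/
  cuspY : ℤ → Set (Subgroup PiY)
  /-- cusps of `X` labelled by `(ℤ/lℤ)^±` (Cor 2.9, p.43): label ↦ cuspidal decomposition
  groups in `Π^tp_X` … -/
  cuspX : ZMod l → Set (Subgroup PiX)
  /-- … depending only on the class in `(ℤ/lℤ)^± = (ℤ/lℤ)/{±1}` -/
  cuspX_neg : ∀ a, cuspX (-a) = cuspX a
  /-- `Ÿ → Y` is geometric (`K = K̈`, Def 2.5, p.39; `Gal(Ÿ/X) ≅ (l·ℤ) × μ₂`, p.41): `Π^tp_Ÿ ↠ G_K` -/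
  augYdd_surjective : Function.Surjective (aug.comp PiYdd.subtype)
  /-- "the various `s^Θ_Ÿ` that arise from different choices of [a cocycle in] a class `∈ η̈^{Θ,l·ℤ×μ₂}`
  are obtained as `Π^tp_X[μ_N]`-conjugates of any given `s^Θ_Ÿ`" and "replacing `η̈^{Θ,l·ℤ×μ₂}` by an
  `O_K^×`-multiple corresponds to replacing `s^Θ_Ÿ` by an `O_K^×`-conjugate" (pp.46–47): all theta
  sections of the collection are `K^×, (l·ℤ)`-conjugate -/
  thetaSections_conj : ∀ (η η' : PiYdd → mu) (hη : η ∈ thetaCocycles) (hη' : η' ∈ thetaCocycles),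
    toThetaEnvData.IsKLConjugate (toThetaEnvData.sTheta hη) (toThetaEnvData.sTheta hη')

namespace RigidData

variable {N : ℕ+} {l : ℕ} (R : RigidData.{u} N l)

/-- The image `s^alg_Ÿ(H ∩ Π^tp_Ÿ) ⊆ Π^tp_Y[μ_N]` of a subgroup `H ⊆ Π^tp_X`.
[cite: MochizukiEtTh2009, Prop 2.14(i) p.49] -/
def algImage (H : Subgroup R.PiX) : Subgroup R.env :=
  (H.subgroupOf R.PiYdd).map R.toThetaEnvData.sAlg

/-- The image `s^Θ_Ÿ(H ∩ Π^tp_Ÿ)` under the theta section of a cocycle `η`.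
[cite: MochizukiEtTh2009, Cor 2.19(i) p.64] -/
def thetaImage {η : R.PiYdd → R.mu} (hη : η ∈ R.thetaCocycles) (H : Subgroup R.PiX) :
    Subgroup R.env :=
  (H.subgroupOf R.PiYdd).map (R.toThetaEnvData.sTheta hη)

/-! ## Proposition 2.12 (the cyclotomic envelope of the theta quotient) -/

/-- The image `s^alg_X(H) ⊆ Π^tp_X[μ_N]` of `H ⊆ Π^tp_X` under the tautological section of the
envelope of `Π^tp_X` itself (Prop 2.12 concerns `Δ_* = Δ^tp_X`, not `Δ^tp_Y`).
[cite: MochizukiEtTh2009, Prop 2.12(ii) p.45] -/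
def algImageX (H : Subgroup R.PiX) : Subgroup (CycEnvelope R.aug R.chi) :=
  H.map (CycEnvelope.algSection R.aug R.chi)

/-- **Proposition 2.12 (i)** for `Δ_* = Δ^tp_X` (type `(1,(ℤ/lℤ)^Θ)`): "we have an inclusion
`Ker(Δ^Θ_* ↠ Δ^ell_*) = l·Δ_Θ ⊆ [Δ^Θ_*, Δ^Θ_*]` of subgroups of `Δ^Θ_*`", pulled back to `Π^tp_X`:
`(l·Δ_Θ) ⊆ [Δ_X, Δ_X] · thetaKer` (abstract commutator subgroup — TODO(general form): the
printed bracket may denote the closed commutator subgroup). ERRATUM ([IUTchI] Rmk 3.1.6): the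
case `Ċ` of the printed list `Δ_*` must be excluded; this interface covers `X` only.
[cite: MochizukiEtTh2009, Prop 2.12(i) p.45] -/
def Prop212_i : Prop :=
  R.lDeltaTheta ≤ ⁅R.aug.ker, R.aug.ker⁆ ⊔ R.thetaKer

/-- **Proposition 2.12 (ii)**: "the intersection `[Δ^Θ_*[μ_N], Δ^Θ_*[μ_N]] ∩ (l·Δ_Θ)[μ_N]`
coincides with the image of the restriction of the tautological section of `Δ^Θ_*[μ_N] ↠ Δ^Θ_*`
to `l·Δ_Θ`", pulled back to `Δ_X[μ_N] ⊆ Π^tp_X[μ_N]` (i.e. modulo `s^alg(thetaKer)`).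
[cite: MochizukiEtTh2009, Prop 2.12(ii) p.45] -/
def Prop212_ii : Prop :=
  (⁅CycEnvelope.deltaEnv R.aug R.chi, CycEnvelope.deltaEnv R.aug R.chi⁆ ⊔ R.algImageX R.thetaKer) ⊓
      (R.algImageX R.lDeltaTheta ⊔ (CycEnvelope.proj R.aug R.chi).ker) =
    R.algImageX R.lDeltaTheta

/-! ### Remark 2.12.1 (p.46): the inclusion of Prop 2.12 (i) fails for the once-dotted / singly
underlined covers (problems at `2` and at primes dividing `l`); "the original motivation for the
introduction of the slightly complicated coverings" — commentary, no decl. -/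

/-! ## Proposition 2.14 (symmetries of mono- and bi-theta environments) -/

/-- The automorphisms "`γ`" of Prop 2.14 (i): bi-continuous automorphisms of `Π^tp_Y[μ_N]` whose
image in `Out` lies in `D_Y` and which induce the identity on `Π^tp_Y[μ_N] ↠ Π^tp_Y ↠ G_K`.
[cite: MochizukiEtTh2009, Prop 2.14(i) p.49] -/
def DYAut : Set (MulAut R.env) :=
  {γ | ∃ hc : γ ∈ contMulAut R.env, TopOut.mk _ ⟨γ, hc⟩ ∈ R.DY ∧
      ∀ x, R.augY (CycEnvelope.proj R.augY R.chi (γ x)) = R.augY (CycEnvelope.proj R.augY R.chi x)}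

/-- **Proposition 2.14 (i)**: the subset `{γ(β)·β⁻¹ | β ∈ (Δ^tp_Y)^Θ[μ_N], γ as above}` of
`(Δ^tp_Ÿ)^Θ[μ_N] ⊇ (l·Δ_Θ)[μ_N]` coincides with the image of the tautological section of
`(l·Δ_Θ)[μ_N] ↠ (l·Δ_Θ)` — typed in `Π^tp_Y[μ_N]` modulo `s^alg(thetaKer)`.
[cite: MochizukiEtTh2009, Prop 2.14(i) p.49] -/
def Prop214_i : Prop :=
  ∀ x : R.env, (∃ γ ∈ R.DYAut, ∃ β ∈ CycEnvelope.deltaEnv R.augY R.chi, ∃ k ∈ R.algImage R.thetaKer,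
      x = γ β * β⁻¹ * k) ↔ x ∈ R.algImage R.lDeltaTheta

/-- **Proposition 2.14 (ii)**: for `t^Θ` a `K^×, (l·ℤ)`-conjugate of `s^Θ`, the difference cocycle
`δ = t^Θ − s^Θ` on `Π^tp_Ÿ` extends to a cocycle of `Π^tp_Y`, so that the shift `α̈_δ` extends to
`α_δ ∈ Aut(Π^tp_Y[μ_N])` inducing the identity on `Π^tp_Y` and on `μ_N`; conjugation by `α_δ`
maps `s^Θ` to `t^Θ` and preserves `D_Y ⊆ Out(Π^tp_Y[μ_N])`.
[cite: MochizukiEtTh2009, Prop 2.14(ii) p.49] -/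
def Prop214_ii : Prop :=
  ∀ (η : R.PiYdd → R.mu) (hη : η ∈ R.thetaCocycles) (t : R.PiYdd → R.env),
    R.IsKLConjugate (R.toThetaEnvData.sTheta hη) t →
    ∃ (δ : R.PiY → R.mu) (hδ : CycEnvelope.IsEnvCocycle R.augY R.chi δ)
      (hc : CycEnvelope.shift hδ ∈ contMulAut R.env),
      (∀ g, CycEnvelope.shift hδ (R.toThetaEnvData.sTheta hη g) = t g) ∧
      R.DY.map (MulAut.conj (TopOut.mk _ ⟨_, hc⟩)).toMonoidHom = R.DY

/-- An automorphism `ᾱ` of `Π^tp_Y` is *induced* by an automorphism `α` of `Π^tp_Y[μ_N]`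
(Prop 2.11 (ii): every `α` induces one). [cite: MochizukiEtTh2009, Prop 2.14(iii) p.49] -/
def Induces (α : MulAut R.env) (a : R.PiY ≃ₜ* R.PiY) : Prop :=
  ∀ x, CycEnvelope.proj R.augY R.chi (α x) = a (CycEnvelope.proj R.augY R.chi x)

/-- `(a, ε) ∈ (l·ℤ) ⋊ {±1}` *describes* an automorphism `ᾱ` of `Π^tp_Y` on cusps: the cusp class
labelled `n` goes to the class labelled `ε n + a` (p.49–50).
[cite: MochizukiEtTh2009, Prop 2.14(iii) p.50] -/
def ActsOnCuspsBy (a : R.PiY ≃ₜ* R.PiY) (s : ℤ) (ε : ℤˣ) : Prop :=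
  ∀ n : ℤ, (fun H => H.map a.toMulEquiv.toMonoidHom) '' R.cuspY n = R.cuspY (ε * n + s)

/-- **Proposition 2.14 (iii)**, mono-theta case: every automorphism of the model mono-theta
environment `M` induces an automorphism of `Π^tp_Y`, hence of the cusps of `Y`, acting on the
labels by an element of `(l·ℤ) ⋊ {±1}`; and `Aut(M) → (l·ℤ) ⋊ {±1}` is SURJECTIVE.
[cite: MochizukiEtTh2009, Prop 2.14(iii) p.49] -/
def Prop214_iii_mono : Prop :=
  ∀ (η : R.PiYdd → R.mu) (hη : η ∈ R.thetaCocycles),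
    (∀ α : (R.modelMono hη).Iso (R.modelMono hη), ∃ a, R.Induces α.e.toMulEquiv a ∧
        ∃ (s : ℤ) (ε : ℤˣ), (l : ℤ) ∣ s ∧ R.ActsOnCuspsBy a s ε) ∧
    ∀ (s : ℤ) (ε : ℤˣ), (l : ℤ) ∣ s →
      ∃ (α : (R.modelMono hη).Iso (R.modelMono hη)) (a : R.PiY ≃ₜ* R.PiY),
        R.Induces α.e.toMulEquiv a ∧ R.ActsOnCuspsBy a s ε

/-- **Proposition 2.14 (iii)**, bi-theta case: the image `Im_N` of `Aut(B) → (l·ℤ) ⋊ {±1}`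
satisfies `(N·l·ℤ) ⋊ {±1} ⊆ Im_N ⊆ (N†·l·ℤ) ⋊ {±1}`, `N† = N` (`N` odd), `N/2` (`N` even).
[cite: MochizukiEtTh2009, Prop 2.14(iii) p.50] -/
def Prop214_iii_bi : Prop :=
  ∀ (η : R.PiYdd → R.mu) (hη : η ∈ R.thetaCocycles),
    let Ndag : ℤ := if Odd (N : ℕ) then (N : ℤ) else (N : ℤ) / 2
    (∀ α : (R.modelBi hη).Iso (R.modelBi hη), ∃ a, R.Induces α.e.toMulEquiv a ∧
        ∃ (s : ℤ) (ε : ℤˣ), Ndag * l ∣ s ∧ R.ActsOnCuspsBy a s ε) ∧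
    ∀ (s : ℤ) (ε : ℤˣ), (N : ℤ) * l ∣ s →
      ∃ (α : (R.modelBi hη).Iso (R.modelBi hη)) (a : R.PiY ≃ₜ* R.PiY),
        R.Induces α.e.toMulEquiv a ∧ R.ActsOnCuspsBy a s ε

/-! ### Remarks 2.14.1–2.14.3 (p.51). 2.14.1: `α_δ` does NOT extend to `Π^tp_X[μ_N]` ("since `Ü²`
fails to descend from `Y` to `X`"). 2.14.2: replacing `Gal(Y/X)` by `Gal(Y/C)` forces enlarging
`D_Y` by Kummer classes of powers of `Ü⁴`, after which Prop 2.14 (i) fails. 2.14.3: the shifting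
automorphisms = "nonexistence of a mono-theta-theoretic basepoint"; a bi-theta environment
determines "a basepoint modulo `N†`". Commentary — no decls. -/

/-! ### Remark 2.14.1 (p.51), mathematical content: "although `α̈_δ` extends to an automorphism
`α_δ` of `Π^tp_Y[μ_N]`, the automorphism `α_δ` fails to extend to `Π^tp_X[μ_N]` [since `Ü²` fails to
descend from `Y` to `X`]" — a non-extendability claim about the generic `δ` of Prop 2.14 (ii); it is
false in degenerate instances of the interface (e.g. `N = 1`), so it is recorded here as documentation
of the MODEL, not as a named fact over `RigidData`. -/

/-! ## Corollary 2.18 (group-theoretic construction of mono-theta environments) -/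

/-- **Corollary 2.18 (i)** (Theta-related Subquotients): the subquotients `Π^tp_Y`, `Π^tp_Ÿ`,
`(Π^tp_X ⊇) G_K` [i.e. `Δ_X`], `(l·Δ_Θ)`, `(Δ^tp_X)^Θ`, `(Π^tp_X)^Θ` [i.e. `thetaKer`], `(Δ^tp_Y)^Θ`,
`(Π^tp_Y)^Θ` of `Π^tp_X`, and the cuspidal decomposition groups with their labels `∈ (ℤ/lℤ)^±`,
are reconstructed by a functorial group-theoretic algorithm — typed (see the module doc) as
invariance under every automorphism of the topological group `Π^tp_X`.
[cite: MochizukiEtTh2009, Cor 2.18(i) p.60] -/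
def Cor218_i : Prop :=
  ∀ γ : R.PiX ≃ₜ* R.PiX,
    R.PiY.map γ.toMulEquiv.toMonoidHom = R.PiY ∧ R.PiYdd.map γ.toMulEquiv.toMonoidHom = R.PiYdd ∧
    R.aug.ker.map γ.toMulEquiv.toMonoidHom = R.aug.ker ∧
    R.thetaKer.map γ.toMulEquiv.toMonoidHom = R.thetaKer ∧
    R.lDeltaTheta.map γ.toMulEquiv.toMonoidHom = R.lDeltaTheta ∧
    ∀ a : ZMod l, (fun H => H.map γ.toMulEquiv.toMonoidHom) '' R.cuspX a = R.cuspX a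

/-- **Corollary 2.18 (ii)** (From Topological Groups to Mono-theta Environments): the model
construction `Π^tp_X ↦ {M_ι}` yields mono-theta environments that are pairwise isomorphic via
isomorphisms inducing the IDENTITY on `Π• ↠ Π•_Y` — "precisely the content of Prop 2.14 (ii)":
for any two cocycles of the collection the models are so isomorphic.
[cite: MochizukiEtTh2009, Cor 2.18(ii) p.60] -/
def Cor218_ii : Prop :=
  ∀ (η η' : R.PiYdd → R.mu) (hη : η ∈ R.thetaCocycles) (hη' : η' ∈ R.thetaCocycles),
    ∃ e : (R.modelMono hη).Iso (R.modelMono hη'),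
      ∀ x, CycEnvelope.proj R.augY R.chi (e.e x) = CycEnvelope.proj R.augY R.chi x

/-- **Corollary 2.18 (iii)**, first part (From Mono-theta Environments to Topological Groups): the
quotient `Π• ↠ Π•_Y` of a mono-theta environment is group-theoretic — its kernel is the union of
the centralisers of the open subgroups (Prop 2.11 (ii)); typed for the model.
[cite: MochizukiEtTh2009, Cor 2.18(iii) p.61] -/
def Cor218_iii_quotient : Prop :=
  centralizerUnion R.env = (CycEnvelope.proj R.augY R.chi).ker

/-- **Corollary 2.18 (iii)**, second part: `Π•_X := Aut(Π•_Y) ×_{Out(Π•_Y)} Im(D_Π•) ≅ Π^tp_X`.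
Since the Kummer part of `D_Y` acts trivially on `Π^tp_Y`, `Im(D_Y) ⊆ Out(Π^tp_Y)` is the image of
`Π^tp_X`, and the content is that conjugation `Π^tp_X → Aut(Π^tp_Y)` is INJECTIVE
(temp-slimness) [its image is then the stated fibre product tautologically].
[cite: MochizukiEtTh2009, Cor 2.18(iii) p.61] -/
def Cor218_iii_PiX : Prop :=
  ∀ x : R.PiX, (∀ h : R.PiY, x * h * x⁻¹ = h) → x = 1

/-- `μ_N`-conjugacy of isomorphisms of model environments (the superscript "`μ`" of Cor 2.18 (iv)).
[cite: MochizukiEtTh2009, Cor 2.18(iv) p.61] -/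
def MuConj (α β : MulAut R.env) : Prop :=
  ∃ c : R.mu, β = MulAut.conj (CycEnvelope.inMu R.augY R.chi c) * α

/-- **Corollary 2.18 (iv)** (Lifting Isomorphisms), surjectivity: every automorphism of the
topological group `Π^tp_X` lifts to an automorphism of the model mono-theta environment
(inducing `γ|_{Π^tp_Y}` on the quotient `Π^tp_Y`). [cite: MochizukiEtTh2009, Cor 2.18(iv) p.61] -/
def Cor218_iv_surjective : Prop :=
  ∀ (η : R.PiYdd → R.mu) (hη : η ∈ R.thetaCocycles) (γ : R.PiX ≃ₜ* R.PiX)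
    (_ : R.PiY.map γ.toMulEquiv.toMonoidHom = R.PiY),
    ∃ α : (R.modelMono hη).Iso (R.modelMono hη),
      ∀ x, ((CycEnvelope.proj R.augY R.chi (α.e x) : R.PiY) : R.PiX) =
        γ (CycEnvelope.proj R.augY R.chi x : R.PiY)

/-- **Corollary 2.18 (iv)**, fibres: the automorphisms of the model inducing the identity on
`Π^tp_Y` are, up to `μ_N`-conjugacy, exactly the twists `x ↦ φ(x̄)·x` by homomorphisms
`φ ∈ Hom(Π^tp_Y/Π^tp_Ÿ, μ_N)` ("`Hom(Π•_Y/Π•_Ÿ, Ker(Π• ↠ Π•_Y))`", p.63) — a group of cardinality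
`1` (`N` odd) resp. `2` (`N` even). [cite: MochizukiEtTh2009, Cor 2.18(iv) p.61] -/
def Cor218_iv_fibre : Prop :=
  ∀ (η : R.PiYdd → R.mu) (hη : η ∈ R.thetaCocycles),
    (∀ α : (R.modelMono hη).Iso (R.modelMono hη),
      (∀ x, CycEnvelope.proj R.augY R.chi (α.e x) = CycEnvelope.proj R.augY R.chi x) →
      ∃ (φ : R.PiY →* R.mu) (_ : ∀ g : R.PiYdd, φ (R.inclYdd g) = 1) (c : R.mu),
        ∀ x : R.env, α.e x = MulAut.conj (CycEnvelope.inMu R.augY R.chi c)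
          (CycEnvelope.inMu R.augY R.chi (φ (CycEnvelope.proj R.augY R.chi x)) * x)) ∧
    (∀ (φ : R.PiY →* R.mu), (∀ g : R.PiYdd, φ (R.inclYdd g) = 1) →
      ∃ α : (R.modelMono hη).Iso (R.modelMono hη),
        ∀ x : R.env,
          α.e x = CycEnvelope.inMu R.augY R.chi (φ (CycEnvelope.proj R.augY R.chi x)) * x)

/-! ### Remarks 2.18.1–2.18.2 (p.63). 2.18.1: the bijectivity in Cor 2.18 (iv) [for `N/M` odd]
is false for bi-theta environments (by Prop 2.14 (iii)). 2.18.2: "a mono-theta environment may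
be regarded as an object naturally constructed from/associated to the tempered fundamental
group" and also to a certain Frobenioid (§5) — commentary, no decls. -/

/-! ## Corollary 2.19 (i) (cyclotomic rigidity) -/

/-- **Corollary 2.19 (i)** (Cyclotomic Rigidity), subquotients: the subquotients
`Π•|_(l·Δ•Θ) ⊆ Π•|_(Δ•_Y)^Θ ⊆ Π•|_(Π•_Y)^Θ` of a mono-theta environment are group-theoretic —
typed as: every automorphism of the model `M_N` preserves `s^alg(Ker(Π^tp_Ÿ ↠ (Π^tp_Ÿ)^Θ))`
[the kernel defining `(Π_Y)^Θ[μ_N]`], `μ_N · s^alg(l·Δ_Θ)` and `Δ^tp_Y[μ_N] = μ_N × Δ^tp_Y`.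
[cite: MochizukiEtTh2009, Cor 2.19(i) p.64] -/
def Cor219_i_subquotients : Prop :=
  ∀ (η : R.PiYdd → R.mu) (hη : η ∈ R.thetaCocycles) (α : (R.modelMono hη).Iso (R.modelMono hη)),
    (R.algImage R.thetaKer).map α.e.toMulEquiv.toMonoidHom = R.algImage R.thetaKer ∧
    (R.algImage R.lDeltaTheta ⊔ (CycEnvelope.proj R.augY R.chi).ker).map
        α.e.toMulEquiv.toMonoidHom =
      R.algImage R.lDeltaTheta ⊔ (CycEnvelope.proj R.augY R.chi).ker ∧
    (CycEnvelope.deltaEnv R.augY R.chi).map α.e.toMulEquiv.toMonoidHom =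
      CycEnvelope.deltaEnv R.augY R.chi

/-- **Corollary 2.19 (i)** (Cyclotomic Rigidity), the two splittings: every automorphism of the
model `M_N` preserves BOTH splittings of `Π•|_(l·Δ•Θ) ↠ (l·Δ•Θ)` — the theta one `s^Θ(l·Δ_Θ)`
(part of the data) AND the algebraic one `s^alg(l·Δ_Θ)` (reconstructed via Prop 2.14 (i)); hence
the isomorphism of cyclotomes `(l·Δ•Θ) ⊗ ℤ/Nℤ ≅ Π•μ` given by their difference (`= thetaMod`,
cf. `cocycle_lDeltaTheta`) is an invariant of the mono-theta environment.
[cite: MochizukiEtTh2009, Cor 2.19(i) p.64] -/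
def Cor219_i_splittings : Prop :=
  ∀ (η : R.PiYdd → R.mu) (hη : η ∈ R.thetaCocycles) (α : (R.modelMono hη).Iso (R.modelMono hη)),
    (R.algImage R.lDeltaTheta).map α.e.toMulEquiv.toMonoidHom = R.algImage R.lDeltaTheta ∧
    (R.thetaImage hη R.lDeltaTheta).map α.e.toMulEquiv.toMonoidHom = R.thetaImage hη R.lDeltaTheta

/-- **Corollary 2.19 (i)**, the cyclotomic rigidity isomorphism of the MODEL: the difference of
the algebraic and theta splittings over `l·Δ_Θ` is `thetaMod : (l·Δ_Θ) ↠ μ_N`, inducing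
`(l·Δ_Θ) ⊗ ℤ/Nℤ ≅ μ_N` ("the natural isomorphism of cyclotomes determined by `s^alg`, `s^Θ`").
PROVED from the interface axioms. [cite: MochizukiEtTh2009, Cor 2.19(i) p.64] -/
theorem sAlg_mul_sTheta_inv {η : R.PiYdd → R.mu} (hη : η ∈ R.thetaCocycles) (g : R.PiYdd)
    (hg : (g : R.PiX) ∈ R.lDeltaTheta) :
    R.toThetaEnvData.sAlg g * (R.toThetaEnvData.sTheta hη g)⁻¹ =
      CycEnvelope.inMu R.augY R.chi (R.thetaMod ⟨g, hg⟩) := by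
  rw [← R.cocycle_lDeltaTheta η hη g hg]
  ext
  · simp [ThetaEnvData.sAlg, ThetaEnvData.sTheta]
  · simp [ThetaEnvData.sAlg, ThetaEnvData.sTheta]

/-! ### Remarks 2.19.1–2.19.5 (pp.66–69): 2.19.1 profinite `l = ∞` coverings would annihilate
differentials; 2.19.2 cyclotomic rigidity fails for `M`-th powers (`M > 1`) of the `l`-th root of
the theta function (rigid only on `M·μ_N`); 2.19.3 `(l·Δ_Θ) ≅ Δ[μ_∞]` as an "integral structure";
2.19.4 what discrete/cyclotomic rigidity buy (values in `K^×`, not `(K^×)^∧`); 2.19.5 the two-layer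
isomorphism of cyclotomes vs. Griffiths semi-transversality. Commentary — no decls. -/

end RigidData

end Literature.AnabelianGeometry.EtaleTheta
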